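import Summits.QuantumFields.YangMills.Theorems.BalabanLadderInfVolCeilingsDefs
import Summits.QuantumFields.YangMills.Theorems.BalabanLadderInfVolCeilingsDLR
import Summits.QuantumFields.YangMills.Theorems.InfiniteVolumeMomentBounds
import Summits.QuantumFields.YangMills.Theses.BalabanLadder
import Literature.MathematicalPhysics.QuantumLattice.LatticeGaugeDLRGibbsProofs
import HarnessLib

/-!
# The volume-free E0′ ceilings: DLR ⇒ IV ⇒ TL, the two feeds (`MomentBounds6`, `FBL6`), unit transfer, and the
# reading against the spine `UV ∧ UVSeamRec`

HONEST FRAMING (R136 (i) «parallel continuum programme», seat `ym-infvol-p1`, pre-birth helper; bears on the spine route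
`BalabanLadder`, leaf `UV` = stmt-QuantumFields-19351, crux `UVSeamRec` = stmt-QuantumFields-20043).  Soft theorems over
the NAMED volume-free forms of `Theorems/BalabanLadderInfVolCeilingsDefs.lean` (`MomentBounds6On/TL/IV/DLR`); the two
Yang–Mills inputs `MomentBounds6 G r a` (periodic E0′ ceilings, the output currency of `UV ∧ UVSeamRec`) and
`FBL6 G r a` (the frozen-boundary law, the 20043 lead's kernel-form E0′ residual) are HYPOTHESES; §5 consumes the spine's
OPEN items `UV`, `UVSeamRec` BY NAME as hypotheses.  Nothing about Bałaban's programme, the continuum limit, DLR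
uniqueness or a mass gap is asserted.  Existence half only; not a gap, not Clay.

* §1 `MomentBounds6On.anti` (antitone in the family of states); `momentBounds6IV_of_momentBounds6DLR` (torus limit
  states are DLR states — tree `mem_ymGibbsMeasures_of_mem_infiniteVolumeLimitPoints_holds`, Georgii Thm. 4.17),
  `momentBounds6TL_of_momentBounds6IV` (odd tori are tori), `momentBounds6TL_of_momentBounds6DLR`.
* §2 `momentBounds6On_of_eventually_le` (+ `TL/IV/DLR` instances) — one-sided unit transfer `a ≤ c·u` eventually, the
  companion of `UVSeamRec.CeilingsTransfer.momentBounds6_of_eventually_le`.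
* §3 FEED 1 (periodic): `momentBounds6TL_of_momentBounds6 : MomentBounds6 G r a → MomentBounds6TL G r a` — `exact` the
  landed `InfiniteVolume.momentBounds6_infiniteVolume` of seat p2 (Theorems/InfiniteVolumeMomentBounds.lean).
* §4 FEED 2 (kernel): `momentBounds6DLR_of_fbl6 : FBL6 G r a → MomentBounds6DLR G r a` — `exact` the `ℤ⁴`-DLR collar
  `dlrCeilings_of_fbl6` (Theorems/BalabanLadderInfVolCeilingsDLR.lean); hence `momentBounds6IV_of_fbl6`,
  `momentBounds6TL_of_fbl6`, and — with the torus collar `stub_collar6` — `ceilings_of_fbl6` (all four forms at once).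
* §5 `seamLegsTL_of_uv_uvSeamRec` — AGAINST THE SPINE BY NAME: `BalabanLadder.UV → BalabanLadder.UVSeamRec →` for every
  compact simple `G ≃ₜ* SU(2)` ONE lattice representation `r` with `LowerBounds G r uRec ∧ MomentBounds6 G r uRec ∧
  MomentBounds6TL G r uRec` in the two-loop unit of record `uRec β = exp (FemtoTransferGap.sizeLog β 1)` — the
  infinite-volume E0′ input of an «`L → ∞` first» continuum route, conditional on Track A's UV Prop exactly as the spine.

References: H.-O. Georgii, Gibbs Measures and Phase Transitions (2011) Thm. 4.17; E. Seiler, LNP 159 (1982) Ch. 2;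
A. Jaffe, E. Witten (2006) §5–§6; the tree files above.
-/

set_option autoImplicit false

noncomputable section

open MeasureTheory Filter Topology
open scoped BigOperators
open Literature.MathematicalPhysics.QuantumFieldTheory hiding ZdEdge
open Literature.MathematicalPhysics.QuantumLattice
open Summit.QuantumFields.YangMills.Cruxes.OSLegsFromFemtoAndGap.DlrCollarTransfer

namespace Summit.QuantumFields.YangMills.Theorems.InfiniteVolume

/-! ## §1 Monotonicity in the family of states; DLR ⇒ IV ⇒ TL -/

section Mono

variable {G : Type} [Group G] [TopologicalSpace G] [IsTopologicalGroup G] [CompactSpace G]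
  [MeasurableSpace G] [BorelSpace G] (r : LatticeRep G) (a : ℝ → ℝ)

omit [IsTopologicalGroup G] [CompactSpace G] [BorelSpace G] in
/-- The volume-free ceilings are antitone in the family of states (same constants). [folklore] -/
theorem MomentBounds6On.anti {S S' : ℝ → Set (Measure (LGConfig 4 G))} (hSS' : ∀ β, S β ⊆ S' β)
    (h : MomentBounds6On G r a S') : MomentBounds6On G r a S := by
  obtain ⟨C, β₄, ℓ₄, hℓ₄, hC, H⟩ := h
  exact ⟨C, β₄, ℓ₄, hℓ₄, hC, fun β hβ μ hμ => H β hβ μ (hSS' β hμ)⟩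

/-- Odd-torus limit states are torus limit states (sides `2S_k + 1 = L_k + 1`, `L_k = 2S_k` strictly increasing).
[folklore] -/
theorem oddTorusLimitPoints_subset (β : ℝ) :
    oddTorusLimitPoints r β ⊆ infiniteVolumeLimitPoints (d := 4) r.ρ β := by
  rintro μ ⟨S, hS, hμ⟩
  exact ⟨fun k => 2 * S k, fun i j hij => Nat.mul_lt_mul_of_pos_left (hS hij) two_pos, hμ⟩

/-- **DLR ⇒ IV**: torus limit states are DLR states of the lattice Yang–Mills specification (tree
`mem_ymGibbsMeasures_of_mem_infiniteVolumeLimitPoints_holds`, Georgii Thm. 4.17), so the DLR ceilings bound the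
centred moments of every torus limit state. [folklore] -/
theorem momentBounds6IV_of_momentBounds6DLR (h : MomentBounds6DLR G r a) : MomentBounds6IV G r a := by
  haveI : SecondCountableTopology G :=
    (r.continuous.isClosedEmbedding r.injective).isEmbedding.secondCountableTopology
  haveI : T2Space G := (r.continuous.isClosedEmbedding r.injective).isEmbedding.t2Space
  exact MomentBounds6On.anti r a
    (fun β μ hμ => mem_ymGibbsMeasures_of_mem_infiniteVolumeLimitPoints_holds (d := 4) (ρ := r.ρ) r.continuous hμ) h

/-- **IV ⇒ TL**: odd-torus limit states are torus limit states. [folklore] -/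
theorem momentBounds6TL_of_momentBounds6IV (h : MomentBounds6IV G r a) : MomentBounds6TL G r a :=
  MomentBounds6On.anti r a (oddTorusLimitPoints_subset r) h

/-- **DLR ⇒ TL.** [folklore] -/
theorem momentBounds6TL_of_momentBounds6DLR (h : MomentBounds6DLR G r a) : MomentBounds6TL G r a :=
  momentBounds6TL_of_momentBounds6IV r a (momentBounds6IV_of_momentBounds6DLR r a h)

end Mono

/-! ## §2 One-sided unit transfer -/

section Units

variable {G : Type} [Group G] [TopologicalSpace G] [IsTopologicalGroup G] [CompactSpace G]
  [MeasurableSpace G] [BorelSpace G] (r : LatticeRep G)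

omit [IsTopologicalGroup G] [CompactSpace G] [BorelSpace G] in
/-- **Unit transfer**: the volume-free ceilings see the unit map only through the collar constraint `R · a β ≤ ℓ₄`,
so they pass from a unit `a` to any unit `u` with `a ≤ c · u` eventually (`c > 0`; same `C`, range `ℓ₄ / c`) — the
companion of `UVSeamRec.CeilingsTransfer.momentBounds6_of_eventually_le` (the honest content of «asymptotic scaling
`a_B ≤ c · uRec`» on the ceilings side). [folklore] -/
theorem momentBounds6On_of_eventually_le {S : ℝ → Set (Measure (LGConfig 4 G))} {a u : ℝ → ℝ} {c : ℝ}
    (hc : 0 < c) (hle : ∀ᶠ β in atTop, a β ≤ c * u β) (h : MomentBounds6On G r a S) :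
    MomentBounds6On G r u S := by
  obtain ⟨C, β₄, ℓ₄, hℓ₄, hC, H⟩ := h
  obtain ⟨β₀, hβ₀⟩ := Filter.eventually_atTop.1 hle
  refine ⟨C, max β₄ β₀, ℓ₄ / c, div_pos hℓ₄ hc, hC, fun β hβ μ hμ n q x R hq hR hRu hsep => ?_⟩
  have hβ₄ : β₄ ≤ β := (le_max_left _ _).trans hβ
  have hau : a β ≤ c * u β := hβ₀ β ((le_max_right _ _).trans hβ)
  refine H β hβ₄ μ hμ n q x R hq hR ?_ hsep
  rw [le_div_iff₀ hc] at hRu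
  have hR0 : (0 : ℝ) ≤ R := Nat.cast_nonneg R
  calc (R : ℝ) * a β ≤ R * (c * u β) := mul_le_mul_of_nonneg_left hau hR0
    _ = R * u β * c := by ring
    _ ≤ ℓ₄ := hRu

/-- Unit transfer for the thermodynamic-limit ceilings. [folklore] -/
theorem momentBounds6TL_of_eventually_le {a u : ℝ → ℝ} {c : ℝ} (hc : 0 < c) (hle : ∀ᶠ β in atTop, a β ≤ c * u β)
    (h : MomentBounds6TL G r a) : MomentBounds6TL G r u :=
  momentBounds6On_of_eventually_le r hc hle h

/-- Unit transfer for the DLR ceilings. [folklore] -/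
theorem momentBounds6DLR_of_eventually_le {a u : ℝ → ℝ} {c : ℝ} (hc : 0 < c) (hle : ∀ᶠ β in atTop, a β ≤ c * u β)
    (h : MomentBounds6DLR G r a) : MomentBounds6DLR G r u :=
  momentBounds6On_of_eventually_le r hc hle h

end Units

/-! ## §3 Feed 1 (periodic states): `MomentBounds6 ⇒ MomentBounds6TL` -/

section FeedTorus

variable {G : Type} [Group G] [TopologicalSpace G] [IsTopologicalGroup G] [CompactSpace G]
  [MeasurableSpace G] [BorelSpace G] (r : LatticeRep G)

/-- **The `L`-uniform torus ceilings pass to the odd-torus thermodynamic limit states**, same constants — seat p2's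
`InfiniteVolume.momentBounds6_infiniteVolume` read through the name `MomentBounds6TL` (definitionally the same text,
`momentBounds6TL_iff`). [folklore] -/
theorem momentBounds6TL_of_momentBounds6 {a : ℝ → ℝ} (h : MomentBounds6 G r a) : MomentBounds6TL G r a :=
  momentBounds6_infiniteVolume r h

end FeedTorus

/-! ## §4 Feed 2 (kernels): `FBL6 ⇒ MomentBounds6DLR` -/

section FeedKernel

variable {G : Type} [Group G] [TopologicalSpace G] [IsTopologicalGroup G] [CompactSpace G]
  [MeasurableSpace G] [BorelSpace G] (r : LatticeRep G)

/-- **The frozen-boundary law gives the ceilings for EVERY DLR state** (`C = 2C₁`, `β₄ = β₁`, `ℓ₄ = ℓ₁/5`) — the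
`ℤ⁴`-DLR collar `dlrCeilings_of_fbl6` read through the name `MomentBounds6DLR`. [folklore] -/
theorem momentBounds6DLR_of_fbl6 {a : ℝ → ℝ} (h : FBL6 G r a) : MomentBounds6DLR G r a :=
  dlrCeilings_of_fbl6 r h

/-- `FBL6 ⇒ MomentBounds6IV` (all torus limit states). [folklore] -/
theorem momentBounds6IV_of_fbl6 (a : ℝ → ℝ) (h : FBL6 G r a) : MomentBounds6IV G r a :=
  momentBounds6IV_of_momentBounds6DLR r a (momentBounds6DLR_of_fbl6 r h)

/-- `FBL6 ⇒ MomentBounds6TL` (odd-torus limit states) — through the DLR form; the same conclusion also follows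
through the torus form (`stub_collar6` then `momentBounds6TL_of_momentBounds6`). [folklore] -/
theorem momentBounds6TL_of_fbl6 (a : ℝ → ℝ) (h : FBL6 G r a) : MomentBounds6TL G r a :=
  momentBounds6TL_of_momentBounds6DLR r a (momentBounds6DLR_of_fbl6 r h)

/-- **All four E0′ forms from the frozen-boundary law**: periodic (`MomentBounds6`, the landed torus collar
`stub_collar6`), DLR, IV and TL. [folklore] -/
theorem ceilings_of_fbl6 (a : ℝ → ℝ) (h : FBL6 G r a) :
    MomentBounds6 G r a ∧ MomentBounds6DLR G r a ∧ MomentBounds6IV G r a ∧ MomentBounds6TL G r a :=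
  ⟨stub_collar6 G r a h, momentBounds6DLR_of_fbl6 r h, momentBounds6IV_of_fbl6 r a h, momentBounds6TL_of_fbl6 r a h⟩

end FeedKernel

/-! ## §5 Against the spine: the infinite-volume ceilings from `UV ∧ UVSeamRec` by name -/

section Spine

/-- **The seam legs with the thermodynamic-limit ceilings, from the spine's `UV` and `UVSeamRec` BY NAME.**  IF
Bałaban's apex package holds at the datum of record (`Theses.BalabanLadder.UV`, Track A's leaf,
stmt-QuantumFields-19351) and the seam at the unit of record holds (`Theses.BalabanLadder.UVSeamRec`,
stmt-QuantumFields-20043), THEN for every compact simple `G ≃ₜ* SU(2)` (Borel σ-algebra) ONE lattice representation `r`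
carries the floors `LowerBounds G r uRec`, the periodic ceilings `MomentBounds6 G r uRec` AND the thermodynamic-limit
ceilings `MomentBounds6TL G r uRec`, all in the two-loop unit of record `uRec β = exp (FemtoTransferGap.sizeLog β 1)`.
Pure composition; both hypotheses are OPEN items — nothing about Yang–Mills is asserted. [folklore] -/
theorem seamLegsTL_of_uv_uvSeamRec (hUV : Summit.QuantumFields.YangMills.Theses.BalabanLadder.UV)
    (hSeam : Summit.QuantumFields.YangMills.Theses.BalabanLadder.UVSeamRec)
    (G : Type) [Group G] [TopologicalSpace G] [IsTopologicalGroup G] [CompactSpace G]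
    (hG : IsCompactSimpleLieGroup G) (hcl : Nonempty (G ≃ₜ* Matrix.specialUnitaryGroup (Fin 2) ℂ)) :
    letI : MeasurableSpace G := borel G
    haveI : BorelSpace G := ⟨rfl⟩
    ∃ r : LatticeRep G,
      LowerBounds G r (fun β => Real.exp (Summit.QuantumFields.YangMills.Theorems.FemtoTransferGap.sizeLog β 1)) ∧
        MomentBounds6 G r (fun β => Real.exp (Summit.QuantumFields.YangMills.Theorems.FemtoTransferGap.sizeLog β 1)) ∧
        MomentBounds6TL G r
          (fun β => Real.exp (Summit.QuantumFields.YangMills.Theorems.FemtoTransferGap.sizeLog β 1)) := by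
  letI : MeasurableSpace G := borel G
  haveI : BorelSpace G := ⟨rfl⟩
  obtain ⟨r, hlb, hmb⟩ := hSeam hUV G hG hcl
  exact ⟨r, hlb, hmb, momentBounds6TL_of_momentBounds6 r hmb⟩

end Spine

end Summit.QuantumFields.YangMills.Theorems.InfiniteVolume

end
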